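import Literature.AlgebraicGeometry.Milne1999.SpecialLefschetzGroupInvariantsLetterColouring
import Literature.AlgebraicGeometry.Milne1999.SpecialLefschetzGroupInvariantsSymplectic
import Literature.AlgebraicGeometry.Milne1999.BicommutantSemisimple
import Literature.RepresentationTheory.ClassicalInvariants.InvolutiveModuleFormBlocks
import HarnessLib

/-!
# Milne 1999, Cor. 4.5 / Thm. 3.2 over `ℂ`: the `S(A)`-invariants of `H^{2•}(A(ℂ); ℂ)` are Lefschetz classes

Family `hodge`, layer `Literature/AlgebraicGeometry/Milne1999`, namespace `Literature.AlgebraicGeometry.Milne1999`.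
No definition, no named fact, no `sorry`; DISCHARGES the record `Milne1999_specialLefschetzGroup_invariants_le`
of `Milne1999/LefschetzGroup` (net debt `−1`).  Cell `pub-hodgecm2` (COR-CM), seat `lit-milne`, binder table
`HOME/lit/milne.md` rows M2/M4.

## Source, verbatim

J. S. Milne, *Lefschetz classes on abelian varieties*, Duke Math. J. 96 (1999) 639–675
[`paper:doi-10-1215-s0012-7094-99-09620-5`, held]: Cor. 4.5 (p. 659) "`H^{2*}(A^r)(*)^{L(A)} = D_hom(A^r)_k`";
Thm. 4.4 (p. 658, `L(A) = S(A) ⋊ 𝔾_m` acts through `S(A)` on `H^{2p}(p)`); Thm. 3.2 (p. 653) and Prop. 3.6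
(p. 655) with p. 656 (the invariants of `S(A) = ∏_σ S_σ`, `S_σ ∈ {Sp, O, GL}`, in the tensor algebra are generated
in degree `2`); Prop. 3.3 (p. 653: the degree-`2` invariants are the divisor classes); §2 (pp. 645–651: the
decomposition of `(End⁰(A) ⊗ ℂ, †)` and of `V = H¹` into the three types).

## Proof assembled here (every complex abelian variety `A`)

Degree `0` and degrees `> 2 dim A` as in `SpecialLefschetzGroupInvariantsSymplectic`.  For `1 ≤ p ≤ dim A`: the
rational Kähler class `h` of a projective embedding gives the non-degenerate `Q_h` and `⋀^• u ∈ S(A)`-image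
for every `u ∈ S(A)(ℂ) = unitaryCentralizerGroup A h` (Thm. 4.4, `exteriorPullbackEquiv_mem_specialLefschetzGroup`);
`B = λ ∘ Q_h` is a non-degenerate alternating `Hg`-invariant form (`exists_hodgeInvariant_bilinForm`); the
bicommutant `E'' = End⁰(A) ⊗ ℂ` is semisimple (`isSemisimpleRing_bicommutant`) and `†`-stable
(`rightAdjoint_mem_bicommutant`); the structure theory of [Milne, §2] in the form
`ClassicalInvariants.exists_adaptedColouring_of_isAlgClosed` produces an adapted letter colouring whose block
groups consist of elements of `S(A)(ℂ)` (they commute with `E'' ∋ φ^*` and preserve `B`) and whose kernel classes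
lie in `B¹(A) ⊗ ℂ` (degree-`2` dictionary `sum_smul_cupProduct_mem_hodgeClassSpan_of_forall_comm`, Prop. 3.3);
the letter-coloured criterion `mem_divisorClassesSpan_of_forall_exteriorPullback_eq_of_letterColouring`
(Thm. 3.2 / Prop. 3.6 via the tensor FFTs of `TensorFFTLetterColoured`) concludes.

The invariant-theoretic step is also stated on its own, in the `S(A)(ℂ)`-form consumed on the powers `A^r` and
on `A × A` (Milne §5: Prop. 5.4, Prop. 5.7, Thm. 5.9 use Cor. 4.5 on `A × B`, `A × A`):
`mem_divisorClassesSpan_of_forall_mem_unitaryCentralizerGroup` — for ANY `h ∈ B¹(A) ⊗ ℂ` with `Q_h`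
non-degenerate (e.g. Milne's product classes `Σᵢ prᵢ^* h` of §1 p. 643), a class of `H^{2p}(A(ℂ); ℂ)` fixed by
`⋀^{2p}u` for every `u ∈ S(A)(h) = unitaryCentralizerGroup A h` is a Lefschetz class; the trivial degrees
`p = 0`, `p > dim A` separately (`mem_divisorClassesSpan_of_eq_zero_or_lt`).
-/

noncomputable section

open scoped BigOperators Matrix
open CategoryTheory
open Literature.AlgebraicTopology.SingularHomology
open Literature.AlgebraicGeometry.HodgeTheory
open Literature.AlgebraicGeometry.Motives
open Literature.AlgebraicGeometry.VanGeemen1994 (pullbackOne hodgeClassSpan)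
open Literature.Barriers.HodgeConjecture (divisorClassesSpan divisorMonomials mem_divisorMonomials_zero)
open Literature.Geometry.Kaehler (lefschetzPow)
open Literature.RepresentationTheory.ClassicalInvariants

namespace Literature.AlgebraicGeometry.Milne1999

/-- **The trivial degrees**: in degree `0` every class is a multiple of the unit class `1 = [A]`, a divisor
monomial, and above the top degree `2 dim A` there are no classes (`H^{2p}(A(ℂ); ℂ) = ⋀^{2p} H¹ = 0` for
`p > dim A`). [cite: Milne1999LefschetzClasses, Thm. 3.2 (p. 653)] [cite: HatcherAT2002, §3.2 Example 3.16] -/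
theorem mem_divisorClassesSpan_of_eq_zero_or_lt (A : AbelianVariety ℂ) {p : ℕ} (hp : p = 0 ∨ A.dim < p)
    (x : complexBetti A.X (2 * p)) : x ∈ divisorClassesSpan A.X A.dim p := by
  classical
  haveI : Module.Finite ℂ (complexBetti A.X 1) := abelianVarietyCohomologyExteriorH1_holds.finite_one A
  have hX := AbelianVariety.hasExteriorCohomologyH1_complexPoints A
  rcases Nat.eq_zero_or_pos p with rfl | hp1
  · -- degree `0`: everything is a multiple of the unit class
    have htop : Submodule.span ℂ (Set.range (cupPowOne ℂ (ComplexPoints A.X) 0)) = ⊤ :=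
      hX.span_range_cupPowOne 0
    have hrange : Set.range (cupPowOne ℂ (ComplexPoints A.X) 0) =
        {singularCohomology.one ℂ (ComplexPoints A.X)} := by
      ext c
      simp only [Set.mem_range, cupPowOne_zero, Set.mem_singleton_iff]
      exact ⟨fun ⟨_, e⟩ => e.symm, fun e => ⟨fun i => Fin.elim0 i, e.symm⟩⟩
    have hx' : x ∈ Submodule.span ℂ (Set.range (cupPowOne ℂ (ComplexPoints A.X) 0)) := by
      rw [htop]; exact Submodule.mem_top
    rw [hrange] at hx'
    refine Submodule.span_mono (fun c hc => ?_) hx'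
    rw [Set.mem_singleton_iff] at hc
    exact mem_divisorMonomials_zero.2 hc
  · -- degrees above the top: no classes
    have hpA : A.dim < p := hp.resolve_left (by omega)
    haveI : Subsingleton (complexBetti A.X (2 * p)) :=
      hX.subsingleton_of_lt (by rw [AbelianVariety.finrank_complexBetti_one]; omega)
    rw [Subsingleton.elim x 0]
    exact Submodule.zero_mem _

/-- **Milne 1999, Thm. 3.2 / Prop. 3.6 with Prop. 3.3 over `ℂ`, in `S(A)(ℂ)`-form, for EVERY complex abelian
variety and EVERY non-degenerate divisor class `h`** ("the `k`-algebra `H^*(A^r)^{S(A)}` is generated by divisor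
classes"; Prop. 3.3: "`H²(A^r)^{S(A)}` is generated by divisor classes"; `S(A) = {γ ∈ C(A) | γ†γ = 1}` for the
involution of ANY ample `D`, §1 p. 644, here any `h ∈ B¹(A) ⊗ ℂ` with `Q_h` non-degenerate — the form met by
Milne's product classes `D = Σᵢ A × ⋯ × Dᵢ × ⋯ × A` on `A^r` and `A × B`, §1 p. 643, §5): for `1 ≤ p ≤ dim A`,
a class `x ∈ H^{2p}(A(ℂ); ℂ)` with `⋀^{2p}u x = x` for every `u ∈ unitaryCentralizerGroup A h` lies in
`Dᵖ_hom(A)_ℂ = divisorClassesSpan A.X (dim A) p`. Proof as in the module docstring (adapted letter colouring of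
`(H¹, λ ∘ Q_h, End⁰(A) ⊗ ℂ)` + the letter-coloured first fundamental theorems).
[cite: Milne1999LefschetzClasses, Thm. 3.2 and Prop. 3.3 (p. 653), Prop. 3.6 (p. 655), p. 656, §1 pp. 643–644, §2 pp. 645–651] -/
theorem mem_divisorClassesSpan_of_forall_mem_unitaryCentralizerGroup_of_pos (A : AbelianVariety ℂ)
    {h : complexBetti A.X 2} (hh : h ∈ hodgeClassSpan A.dim A.X 1)
    (hnd : ∀ x : complexBetti A.X 1, (∀ y, polarizationPairingOne A.X h (A.dim - 1) x y = 0) → x = 0)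
    {p : ℕ} (hp1 : 0 < p) (hpA' : p ≤ A.dim) (x : complexBetti A.X (2 * p))
    (hx : ∀ u ∈ unitaryCentralizerGroup A h, exteriorPullback (AbelianVariety.hasExteriorCohomologyH1_complexPoints A)
      (u : complexBetti A.X 1 →ₗ[ℂ] complexBetti A.X 1) (2 * p) x = x) :
    x ∈ divisorClassesSpan A.X A.dim p := by
  classical
  haveI : Module.Finite ℂ (complexBetti A.X 1) := abelianVarietyCohomologyExteriorH1_holds.finite_one A
  have hX := AbelianVariety.hasExteriorCohomologyH1_complexPoints A
  have hA0 : 0 < A.dim := lt_of_lt_of_le hp1 hpA'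
  -- the scalar form `B = λ ∘ Q_h`, the semisimple `†`-stable algebra `E''`, and the adapted colouring
  obtain ⟨Bf, hBalt, hBnd, hBHg, hBiff⟩ := exists_hodgeInvariant_bilinForm hh hnd
  haveI : IsSemisimpleRing (bicommutant A) := isSemisimpleRing_bicommutant A
  have hE : ∀ X ∈ bicommutant A, ∃ Y ∈ bicommutant A, ∀ v w, Bf (Y v) w = Bf v (X w) := by
    intro X hXm
    obtain ⟨X', hX'⟩ := exists_rightAdjoint hBnd X
    exact ⟨X', rightAdjoint_mem_bicommutant hBnd hBHg hXm hX', fun v w => (hX' v w).symm⟩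
  obtain ⟨C⟩ := exists_adaptedColouring_of_isAlgClosed Bf hBnd hBalt (bicommutant A) hE
  letI := C.instFintype
  letI := C.instDecEq
  letI := C.instDec
  have hsq : ∀ a : ℂ, IsSquare a := fun a => IsAlgClosed.exists_eq_mul_self a
  refine mem_divisorClassesSpan_of_forall_exteriorPullback_eq_of_letterColouring C.β C.lcol
    (fun i => if C.IsForm i then formBlockGroup (C.ltr i) (C.Ω i) else glBlockGroup (C.ltr i) (C.ltr₁ i))
    (fun i => if C.IsForm i then formBlockKernels (C.ltr i) (C.Ω i) else glBlockKernels (C.ltr i) (C.ltr₁ i))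
    ?_ ?_ (unitaryCentralizerGroup A h) ?_ ?_ p x hx
  · -- the one-colour first fundamental theorems (Prop. 3.6 (a), (b), (c))
    intro i P _ _ c hsupp hc
    by_cases hi : C.IsForm i
    · simp only [if_pos hi] at hc ⊢
      refine mem_span_pairContraction_of_formBlock_invariant hsq (C.ltr_injective i hi)
        (C.Ω_isAlt_or_isSymm i hi) (C.Ω_nondegenerate i hi) P c (fun w hw => hsupp w ?_) hc
      obtain ⟨q, hq⟩ := hw
      refine ⟨q, fun h => hq ?_⟩
      rw [C.range_ltr i hi]
      exact h
    · simp only [if_neg hi] at hc ⊢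
      refine mem_span_pairContraction_of_glBlock_invariant (C.sum_injective i hi) P c (fun w hw => hsupp w ?_) hc
      obtain ⟨q, hq1, hq2⟩ := hw
      refine ⟨q, fun h => ?_⟩
      have hq : w q ∈ Set.range (C.ltr i) ∪ Set.range (C.ltr₁ i) := by
        rw [C.range_union i hi]; exact h
      exact hq.elim hq1 hq2
  · -- block group matrices are the identity off their colour
    intro i g hg j j' hjj'
    by_cases hi : C.IsForm i
    · simp only [if_pos hi] at hg
      obtain ⟨_, _, _, h3, h4⟩ := hg
      rcases hjj' with h | h
      · exact h3 _ _ (by rw [C.range_ltr i hi]; exact h)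
      · exact h4 _ _ (by rw [C.range_ltr i hi]; exact h)
    · simp only [if_neg hi] at hg
      obtain ⟨_, _, _, _, _, h5, h6⟩ := hg
      rcases hjj' with h | h
      · have hn : j ∉ Set.range (C.ltr i) ∪ Set.range (C.ltr₁ i) := by rw [C.range_union i hi]; exact h
        exact h5 _ _ (fun hh => hn (Or.inl hh)) (fun hh => hn (Or.inr hh))
      · have hn : j' ∉ Set.range (C.ltr i) ∪ Set.range (C.ltr₁ i) := by rw [C.range_union i hi]; exact h
        exact h6 _ _ (fun hh => hn (Or.inl hh)) (fun hh => hn (Or.inr hh))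
  · -- block group elements are realised in `S(A)(ℂ)`
    intro i g hg
    have key : (∀ X ∈ bicommutant A, X * Matrix.toLin C.β C.β g = Matrix.toLin C.β C.β g * X) ∧
        ∀ v w, Bf (Matrix.toLin C.β C.β g v) (Matrix.toLin C.β C.β g w) = Bf v w := by
      by_cases hi : C.IsForm i
      · simp only [if_pos hi] at hg
        exact C.form_group i hi g hg
      · simp only [if_neg hi] at hg
        exact C.pair_group i hi g hg
    obtain ⟨hcomm, hiso⟩ := key
    set T := Matrix.toLin C.β C.β g with hT
    have hinj : Function.Injective T := by
      intro v v' hvv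
      rw [← sub_eq_zero]
      refine hBnd.1 _ fun w => ?_
      rw [← hiso, map_sub, hvv, sub_self, LinearMap.BilinForm.zero_left]
    let u : complexBetti A.X 1 ≃ₗ[ℂ] complexBetti A.X 1 :=
      LinearEquiv.ofBijective T ⟨hinj, LinearMap.surjective_of_injective hinj⟩
    have hu : ∀ v, u v = T v := fun v => rfl
    refine ⟨u, ?_, fun j => ?_⟩
    · refine (mem_unitaryCentralizerGroup_iff_of_bilinForm hBiff u).2 ⟨?_, fun v w => ?_⟩
      · refine mem_centralizerGroup_iff.2 fun φ v => ?_
        rw [hu, hu]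
        have h := LinearMap.congr_fun (hcomm (pullbackOne A φ) (pullbackOne_mem_bicommutant φ)) v
        rw [Module.End.mul_apply, Module.End.mul_apply] at h
        exact h.symm
      · rw [hu, hu, hiso]
    · rw [hu, hT, Matrix.toLin_self]
  · -- kernel classes are divisor classes (Prop. 3.3 via the degree-2 dictionary)
    intro i M hM
    have key : ∃ X ∈ bicommutant A, ∀ v,
        X v = ∑ j, ∑ j', M j j' • (Bf v (C.β j') • C.β j - Bf v (C.β j) • C.β j') := by
      by_cases hi : C.IsForm i
      · simp only [if_pos hi] at hM
        exact C.form_kernel i hi M hM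
      · simp only [if_neg hi] at hM
        exact C.pair_kernel i hi M hM
    obtain ⟨X, hXm, hXv⟩ := key
    have h := sum_smul_cupProduct_mem_hodgeClassSpan_of_forall_comm (ι := Fin C.N × Fin C.N) hA0 hBalt hBnd hBHg
      (fun jj => M jj.1 jj.2) (fun jj => C.β jj.1) (fun jj => C.β jj.2) (T := X)
      (fun v => by rw [hXv v, ← Fintype.sum_prod_type'])
      (fun S hS => (Subalgebra.mem_centralizer_iff ℂ).1 hXm S hS)
    rw [Fintype.sum_prod_type] at h
    exact h


/-- **The `S(A)(ℂ)`-form in all degrees**: for `h ∈ B¹(A) ⊗ ℂ` with `Q_h` non-degenerate, every class of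
`H^{2p}(A(ℂ); ℂ)` fixed by `⋀^{2p}u` for all `u ∈ S(A)(h) = unitaryCentralizerGroup A h` is a Lefschetz class
(`1 ≤ p ≤ dim A`: `…_of_pos`; trivial degrees: `mem_divisorClassesSpan_of_eq_zero_or_lt`). This is the hypothesis
shape in which Cor. 4.5 is consumed on `A × A` (Thm. 5.9) and on the powers `A^r` (Thm. 4.4, Cor. 4.7).
[cite: Milne1999LefschetzClasses, Thm. 3.2 (p. 653), Cor. 4.5 (p. 659), §5 pp. 663–665] -/
theorem mem_divisorClassesSpan_of_forall_mem_unitaryCentralizerGroup (A : AbelianVariety ℂ)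
    {h : complexBetti A.X 2} (hh : h ∈ hodgeClassSpan A.dim A.X 1)
    (hnd : ∀ x : complexBetti A.X 1, (∀ y, polarizationPairingOne A.X h (A.dim - 1) x y = 0) → x = 0)
    (p : ℕ) (x : complexBetti A.X (2 * p))
    (hx : ∀ u ∈ unitaryCentralizerGroup A h, exteriorPullback (AbelianVariety.hasExteriorCohomologyH1_complexPoints A)
      (u : complexBetti A.X 1 →ₗ[ℂ] complexBetti A.X 1) (2 * p) x = x) :
    x ∈ divisorClassesSpan A.X A.dim p := by
  rcases Nat.eq_zero_or_pos p with rfl | hp1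
  · exact mem_divisorClassesSpan_of_eq_zero_or_lt A (Or.inl rfl) x
  by_cases hpA : A.dim < p
  · exact mem_divisorClassesSpan_of_eq_zero_or_lt A (Or.inr hpA) x
  exact mem_divisorClassesSpan_of_forall_mem_unitaryCentralizerGroup_of_pos A hh hnd hp1 (not_lt.1 hpA) x hx

/-- **Milne 1999, Cor. 4.5 with Thm. 4.4 and Thm. 3.2 / Prop. 3.6, over `ℂ`, for EVERY complex abelian variety**:
the classes of `H^{2p}(A(ℂ); ℂ)` fixed by the special Lefschetz group `S(A)` are exactly (here: are contained in)
the `ℂ`-span of the divisor monomials `Dᵖ_hom(A)_ℂ`.  Discharges the record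
`Milne1999_specialLefschetzGroup_invariants_le`. [cite: Milne1999LefschetzClasses, Cor. 4.5 (p. 659), Thm. 4.4,
Thm. 3.2 (p. 653), Prop. 3.6 (p. 655), p. 656, Prop. 3.3, §2 pp. 645–651] -/
theorem Milne1999_specialLefschetzGroup_invariants_le_holds : Milne1999_specialLefschetzGroup_invariants_le := by
  intro A p x hx
  rcases Nat.eq_zero_or_pos p with rfl | hp1
  · exact mem_divisorClassesSpan_of_eq_zero_or_lt A (Or.inl rfl) x
  by_cases hpA : A.dim < p
  · exact mem_divisorClassesSpan_of_eq_zero_or_lt A (Or.inr hpA) x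
  have hpA' : p ≤ A.dim := not_lt.1 hpA
  have hA0 : 0 < A.dim := lt_of_lt_of_le hp1 hpA'
  -- the rational Kähler class of a projective embedding
  obtain ⟨D⟩ := nonempty_kaehlerRationalDatum (AbelianVariety.isSmoothProjective_holds (A := A))
  have hQ : IsRationalClass D.Hη := D.isRationalClass_Hη
  have hK1 : IsKaehlerClass A.dim A.X (((1 : ℝ) : ℂ) • D.Hη) := by
    rw [Complex.ofReal_one, one_smul]
    exact D.isKaehlerClassVia.isKaehlerClass D.isNatural D.isMultiplicative
  have hnd := eq_zero_of_forall_polarizationPairingOne_eq_zero_of_isKaehlerClass_smul' one_ne_zero hK1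
  have hh : D.Hη ∈ hodgeClassSpan A.dim A.X 1 := mem_hodgeClassSpan_one_of_isKaehlerClass_smul hQ one_ne_zero hK1
  have htopne : lefschetzPow D.Hη (A.dim - 1) 2 D.Hη ≠ 0 := lefschetzPow_self_ne_zero_of_isKaehlerClass_smul hA0 hK1
  -- `x` is `S(A)(ℂ)`-invariant (Thm. 4.4), hence a Lefschetz class (Thm. 3.2 in `S(A)(ℂ)`-form)
  exact mem_divisorClassesSpan_of_forall_mem_unitaryCentralizerGroup_of_pos A hh hnd hp1 hpA' x fun u hu =>
    hx _ (exteriorPullbackEquiv_mem_specialLefschetzGroup hA0 hh htopne hnd hu)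

end Literature.AlgebraicGeometry.Milne1999

end
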